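import Summits.PneNP.PneNP.Theorems.ConvexRankGatesLinAlgGateBlindLevelHost
import Summits.PneNP.PneNP.Theorems.ConvexRankGatesLinAlgGateBlindLogWidthPerm

/-!
# Route ConvexRankGates, crux `LinAlgGateBlind` (stmt-PneNP-10681): UNCONDITIONAL lower bound for monotone circuits with permutation-group gates on `≤ m^{7/8-o(1)}` points

Support theorems for the crux (vocabulary of `Theorems/ConvexRankGatesLinAlgGateBlindDefs.lean`). The level-`l` door
theorem `not_computes_clique_of_collapse_level` (`…LevelHost`) at the logarithmic atom width
`L(c,m) = (2c+8)(⌊log₂ m⌋+1)` and the single-gate statement `sgAt_perm_logWidth` (`…LogWidthPerm`) for all `PERM_d`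
with `d log₂ d ≤ m^{7/8}/(log₂ m)^5` give, with no hypothesis left:

* `not_computes_clique_of_isOver_perm_logWidth` — for every `c`, eventually in `m`, for every `d` with
  `d · log₂ d ≤ m^{7/8}/(log₂ m)^5`: NO circuit over `{∧₂, ∨₂} ∪ PERM_d` (membership of a fixed permutation in the
  subgroup of `Sym(d)` generated by the live inputs' permutations; nonabelian, unbounded fan-in, monotone by syntax)
  with `≤ m^c` gates computes `CLIQUE(m, ⌈m^{1/8}⌉)`;
* `not_computes_clique_of_isOver_perm_of_le_rpow` — the same for every `d ≤ m^{3/4}`.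

This supersedes the tree's `not_computes_clique_of_isOver_perm` (`d log₂ d ≤ m^{11/16}/(8 log₂ m)`, width `lOf m`) and
its instance `d = ⌊√m⌋`: the PERM door of the crux is closed unconditionally up to `d = m^{7/8-o(1)}`, the limit of every
union-bound cover at `δ = 1/8` (`ν l² < m/k`). What the crux adds beyond this is the coupling `d = m^c` for ALL `c` (first
open case `c = 1`) and the GRANK gates (Valiant-hard, `sgGRank_forces_dc_lowerBound`). Sources: Razborov 1985, Alon–Boppana
1987 §3; host, planting theorem and chain cover are the tree's. No new definitions. [folklore]
-/

-- `Summit.PneNP.PneNP.…` duplicates `PneNP` BY DESIGN (single-problem summit).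
set_option linter.dupNamespace false

noncomputable section

namespace Summit.PneNP.PneNP.Theorems

open Finset Filter Literature.Computability.Complexity Razborov
open Summit.PneNP.PneNP.Cruxes.LinAlgGateBlind.DnfInvariantWideGatesSeeSmallCliques

/-- **No polynomial-size monotone circuit with permutation-group gates on `≤ m^{7/8-o(1)}` points computes
`CLIQUE(m, ⌈m^{1/8}⌉)` (unconditional).** For every `c`, eventually in `m`, for every `d` with
`d · log₂ d ≤ m^{7/8}/(log₂ m)^5` and every circuit `C` over `{∧₂, ∨₂} ∪ PERM_d` with `C.size ≤ m^c`:
`¬ C.Computes CLIQUE(m, ⌈m^{1/8}⌉)`. Proof: the level-`l` door theorem at `l = L(c,m) = (2c+8)(⌊log₂ m⌋+1)`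
(`2c+8 ≤ L ≤ lOf m` by `logWidth_le_lOf`) with `W = PERM_d`, `P = IsPermGate d`: PERM gates are monotone
(`IsPermGate.monotone`), a `PERM_d` gate over small-clique DNFs collapses to a `PERM_d` term gate (`stub_termCollapse`), and
`sgAt_perm_logWidth` is the single-gate statement at width `L`. [folklore] -/
theorem not_computes_clique_of_isOver_perm_logWidth : ∀ c : ℕ, ∀ᶠ m : ℕ in atTop, ∀ d : ℕ,
    (d : ℝ) * Real.logb 2 d ≤ (m : ℝ) ^ (7 / 8 : ℝ) / Real.logb 2 m ^ 5 →
    ∀ C : Circuit (KEdge m), C.IsOver ({GateFn.and 2, GateFn.or 2} ∪ {g | IsPermGate d g}) →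
      C.size ≤ m ^ c → ¬ C.Computes (cliqueFn m ⌈(m : ℝ) ^ (1 / 8 : ℝ)⌉₊) := by
  intro c
  filter_upwards [not_computes_clique_of_collapse_level c, sgAt_perm_logWidth c, logWidth_le_lOf c]
    with m hhost hSG hLl d hd C hC hsize
  exact hhost ((2 * c + 8) * (Nat.log 2 m + 1)) (Nat.le_mul_of_pos_right _ (Nat.succ_pos _)) hLl
    {g | IsPermGate d g} (IsPermGate d) (fun g (hg : IsPermGate d g) => hg.monotone)
    (fun g (hg : IsPermGate d g) A hA => (stub_termCollapse m d _ g A hA).1 hg) (hSG d hd) C hC hsize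

/-- **The same for every `d ≤ m^{3/4}`** (`sgAt_perm_logWidth_of_le_rpow`). In particular for `d = m^c`-type couplings
with any real exponent `< 3/4`, and for `d = ⌊√m⌋` (the tree's `not_computes_clique_of_isOver_perm_sqrt`). [folklore] -/
theorem not_computes_clique_of_isOver_perm_of_le_rpow : ∀ c : ℕ, ∀ᶠ m : ℕ in atTop, ∀ d : ℕ,
    (d : ℝ) ≤ (m : ℝ) ^ (3 / 4 : ℝ) →
    ∀ C : Circuit (KEdge m), C.IsOver ({GateFn.and 2, GateFn.or 2} ∪ {g | IsPermGate d g}) →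
      C.size ≤ m ^ c → ¬ C.Computes (cliqueFn m ⌈(m : ℝ) ^ (1 / 8 : ℝ)⌉₊) := by
  intro c
  filter_upwards [not_computes_clique_of_collapse_level c, sgAt_perm_logWidth_of_le_rpow c, logWidth_le_lOf c]
    with m hhost hSG hLl d hd C hC hsize
  exact hhost ((2 * c + 8) * (Nat.log 2 m + 1)) (Nat.le_mul_of_pos_right _ (Nat.succ_pos _)) hLl
    {g | IsPermGate d g} (IsPermGate d) (fun g (hg : IsPermGate d g) => hg.monotone)
    (fun g (hg : IsPermGate d g) A hA => (stub_termCollapse m d _ g A hA).1 hg) (hSG d hd) C hC hsize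

/-- **Polynomial couplings below `3/4`.** For every `c` and every real `γ < 3/4`, eventually in `m`: no circuit over
`{∧₂, ∨₂} ∪ PERM_{⌊m^γ⌋₊}` with `≤ m^c` gates computes `CLIQUE(m, ⌈m^{1/8}⌉)` — the crux's own coupling `d = m^γ`
holds unconditionally for every exponent `γ < 3/4` (indeed `< 7/8`, by `not_computes_clique_of_isOver_perm_logWidth`),
whereas the crux asks it for every natural exponent. [folklore] -/
theorem not_computes_clique_of_isOver_perm_rpow_lt : ∀ (c : ℕ) (γ : ℝ), γ ≤ 3 / 4 → ∀ᶠ m : ℕ in atTop,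
    ∀ C : Circuit (KEdge m), C.IsOver ({GateFn.and 2, GateFn.or 2} ∪ {g | IsPermGate ⌊(m : ℝ) ^ γ⌋₊ g}) →
      C.size ≤ m ^ c → ¬ C.Computes (cliqueFn m ⌈(m : ℝ) ^ (1 / 8 : ℝ)⌉₊) := by
  intro c γ hγ
  filter_upwards [not_computes_clique_of_isOver_perm_of_le_rpow c, eventually_ge_atTop 1] with m hm hm1 C hC hsize
  refine hm _ ?_ C hC hsize
  have h0 : (0 : ℝ) ≤ (m : ℝ) ^ γ := Real.rpow_nonneg (Nat.cast_nonneg m) _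
  calc ((⌊(m : ℝ) ^ γ⌋₊ : ℕ) : ℝ) ≤ (m : ℝ) ^ γ := Nat.floor_le h0
    _ ≤ (m : ℝ) ^ (3 / 4 : ℝ) :=
        Real.rpow_le_rpow_of_exponent_le (by exact_mod_cast hm1) hγ

end Summit.PneNP.PneNP.Theorems

end
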